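import Literature.Probability.RandomPlanarGeometry.SAWTriangularStripInsertion
import Literature.Probability.RandomPlanarGeometry.SAWTriangularStripInsertionCore
import HarnessLib

/-!
# `μ(S_T) < μ(S_{T+1}) ≤ μ(𝕋)` for the row strips of the triangular lattice, with an explicit margin

Topic `Literature/Probability/RandomPlanarGeometry` (the leaf of the door «TRI-STRIP-STRICT»:
`SAWTriangularStripInsertion.lean` — the four-column slab insertion `TriStrip.stripInsertion` with its three
properties hcost (`≤ 4T+6`) / hmem / hinj — fed to `SAWTriangularStripInsertionCore.lean` — the summation and the
margin extraction).  Statement shape: N. Madras, G. Slade, *The Self-Avoiding Walk* (1993), §8.2, Theorem 8.2.1,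
eq. (8.2.13), p. 269 ("`μ(R[k,T]) < μ(R[k,T+1])`", stated for the tubes `R[k,T]` of `ℤ^d` and proved there, p. 270,
by bridge renewal; (8.2.11) "`μ(R) < μ`" via the Pattern Theorem).  For the TRIANGULAR lattice the strict monotonicity
of the strip connective constants in the width is, to the lane's knowledge (lit-1 gen 11, ROUTES-G17 §4), not in print;
the proof here is the lane's injective slab insertion, which also yields the explicit margin below.

## Statements (namespace `Literature.Probability.RandomPlanarGeometry.SAW.TriStrip`, all PROVED, standard axioms; every `T`)

* **`log_stripConnectiveConstant_succ_sub_log_ge`** — `log(1 + μ(S_{T+1})^{-(4T+6)}) / (T+1) ≤ log μ(S_{T+1}) − log μ(S_T)`;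
* **`stripConnectiveConstant_lt_succ`** — `μ(S_T) < μ(S_{T+1})`; `strictMono_stripConnectiveConstant_tri`;
* **`stripConnectiveConstant_lt_tri`** — `μ(S_T) < μ(𝕋)`;
* **`logMuTri_sub_log_stripConnectiveConstant_ge`** — the floor `log(1 + μ(𝕋)^{-(4T+6)}) / (T+1) ≤ log μ(𝕋) − log μ(S_T)`
  (the quantitative form of (8.2.11) for triangular strips: the same insertion counted into all walks of `𝕋`).

## Label (lane «pcv-sawmu», lit-2 gen 15 cell of 2026-08-23)

The strict inequality `μ(S_T(𝕋)) < μ(S_{T+1}(𝕋))` served by this file is NEW-IN-WRITING for the triangular lattice, of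
a classical type, by a NEW proof route (injective slab insertion, not the printed renewal / transfer-matrix arguments):
strict monotonicity of strip connective constants is printed for `ℤ^d` [cite: MadrasSlade1993, Theorem 8.2.1 (8.2.13), p. 269 and proof p. 270 (ℤ^d tubes; statement shape — the triangular-strip analogue is not printed there)]
(Hammersley–Whittington 1985, Notes §8.5 p. 278; for `ℤ²` strips also Alm–Janson 1990 via Guttmann–Jensen LNP 775 p. 236)
and for the honeycomb lattice [cite: BeatonBousquetMelouDeGierDuminilCopinGuttmann2014, Proposition 7 (arXiv v5 p. 11: honeycomb strips, y > 0)];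
for triangular strips we located no printed statement («𝕋-strip strict inequality: not located in print (lit-2 g15,
2026-08-23; Alm–Janson 1990 not held, acq-10417)»); the lane's proof is a direct injection rather than the printed
renewal argument.
-/

noncomputable section

open Finset Filter Topology Literature.Probability.LatticeModels Literature.Probability.Percolation

namespace Literature.Probability.RandomPlanarGeometry.SAW.TriStrip

section Door

/-- The injectivity face on the domain `insDom` of the summation step (private: its displayed statement coincides with
the honeycomb twin over different constants). [cite: MadrasSlade1993, §8.2, Theorem 8.2.1 (8.2.13), p. 269 (statement; slab insertion = the lane's proof)] -/
private theorem stripInsertion_injOn_insDom (T n : ℕ) :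
    Set.InjOn (fun q : (Σ _ : Site 2 × (ℕ → Site 2), Finset ℤ) => stripInsertion T n q.1 q.2) ↑(insDom T n) :=
  (stripInsertion_injOn T n).mono fun q hq => by
    obtain ⟨h1, h2⟩ := mem_insDom.1 (Finset.mem_coe.1 hq)
    exact ⟨h1, h2⟩

/-- **Strict strip monotonicity WITH MARGIN on `𝕋`**: for every `T`,
`log(1 + μ(S_{T+1})^{-(4T+6)}) / (T+1) ≤ log μ(S_{T+1}) − log μ(S_T)`.
[cite: MadrasSlade1993, §8.2, Theorem 8.2.1 (8.2.13), p. 269 (statement shape — ℤ^d tubes, no margin; triangular strips and margin: the lane's slab insertion)] -/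
theorem log_stripConnectiveConstant_succ_sub_log_ge (T : ℕ) :
    Real.log (1 + stripConnectiveConstant (T + 1) ^ (-(4 * (T : ℝ) + 6))) / ((T : ℝ) + 1) ≤
      Real.log (stripConnectiveConstant (T + 1)) - Real.log (stripConnectiveConstant T) :=
  log_stripConnectiveConstant_succ_sub_log_ge_of_insertion (Ψ := stripInsertion T) (cost := stripInsertionCost T)
    (fun n p hp c _ => stripInsertionCost_le n p hp c) (fun n p R hp _ => stripInsertion_mem n p R hp)
    (stripInsertion_injOn_insDom T)

/-- **`μ(S_T) < μ(S_{T+1})`** for the row strips of the triangular lattice, every `T`.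
[cite: MadrasSlade1993, §8.2, Theorem 8.2.1 (8.2.13), p. 269 (ℤ^d tubes, proof by bridge renewal p. 270 — not the proof formalised; triangular strips: the lane's slab insertion)] -/
theorem stripConnectiveConstant_lt_succ (k : ℕ) :
    TriStrip.stripConnectiveConstant k < TriStrip.stripConnectiveConstant (k + 1) :=
  stripConnectiveConstant_lt_succ_of_insertion (Ψ := stripInsertion k) (cost := stripInsertionCost k)
    (fun n p hp c _ => stripInsertionCost_le n p hp c) (fun n p R hp _ => stripInsertion_mem n p R hp)
    (stripInsertion_injOn_insDom k)

/-- `T ↦ μ(S_T)` is strictly increasing on `𝕋`. [cite: MadrasSlade1993, §8.2, Theorem 8.2.1 (8.2.13), p. 269 (ℤ^d tubes; triangular strips: the lane's)] -/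
theorem strictMono_stripConnectiveConstant_tri : StrictMono fun k : ℕ => TriStrip.stripConnectiveConstant k :=
  strictMono_nat_of_lt_succ stripConnectiveConstant_lt_succ

/-- **`μ(S_T) < μ(𝕋)`** for every row strip of the triangular lattice.
[cite: MadrasSlade1993, §8.2, Theorem 8.2.1 (8.2.11), p. 269 (ℤ^d, via the Pattern Theorem — not the proof formalised; triangular strips: the lane's)] -/
theorem stripConnectiveConstant_lt_tri (T : ℕ) : stripConnectiveConstant T < Real.exp logMuTri :=
  lt_of_lt_of_le (stripConnectiveConstant_lt_succ T) (stripConnectiveConstant_le (T + 1))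


/-- **Floor of the locality gap on `𝕋`**: `log(1 + μ(𝕋)^{-(4T+6)}) / (T+1) ≤ log μ(𝕋) − log μ(S_T)` for every `T` — the
insertion core counted into all walks of `𝕋` (`c_m(S_{T+1}) ≤ 2(T+2) c_m(𝕋)`), then the lattice-free extraction.
[cite: MadrasSlade1993, §8.2, Theorem 8.2.1 (8.2.11), p. 269 (ℤ^d, "μ(R) < μ", no margin; triangular strips and margin: the lane's slab insertion)] -/
theorem logMuTri_sub_log_stripConnectiveConstant_ge (T : ℕ) :
    Real.log (1 + Real.exp logMuTri ^ (-(4 * (T : ℝ) + 6))) / ((T : ℝ) + 1) ≤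
      logMuTri - Real.log (stripConnectiveConstant T) := by
  have hcore := core_of_insertion (T := T) (Ψ := stripInsertion T) (cost := stripInsertionCost T)
    (fun n p hp c _ => stripInsertionCost_le n p hp c) (fun n p R hp _ => stripInsertion_mem n p R hp)
    (stripInsertion_injOn_insDom T)
  have hμ1 : 1 ≤ Real.exp logMuTri := (one_le_stripConnectiveConstant 0).trans (stripConnectiveConstant_le 0)
  have hB : (0 : ℝ) ≤ 8 * (2 * ((T : ℝ) + 2)) := by positivity
  have hx := MarginExtraction.log_margin_of_core (E := 4 * T + 6) (L := T) (K := 4 * T + 7)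
    (C := fun m => (triSawCount m : ℝ)) (B := 8 * (2 * ((T : ℝ) + 2))) (stripConnectiveConstant_pos T) hμ1 hB
    (fun m => Nat.cast_nonneg _) tendsto_triSawCount_rpow fun n x hx0 hx1 => by
      -- `μ(S_T)ⁿ ≤ c_n(S_T)` ((8.2.3))
      have hpow : stripConnectiveConstant T ^ n ≤ (stripCount T n : ℝ) := by
        rcases Nat.eq_zero_or_pos n with rfl | hn
        · rw [pow_zero]; exact_mod_cast one_le_stripCount T 0
        have h := stripConnectiveConstant_le_rpow T hn.ne'
        have hc : (0 : ℝ) ≤ stripCount T n := Nat.cast_nonneg _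
        calc stripConnectiveConstant T ^ n ≤ ((stripCount T n : ℝ) ^ (1 / (n : ℝ))) ^ n :=
              pow_le_pow_left₀ (stripConnectiveConstant_pos T).le h n
          _ = stripCount T n := by rw [one_div, Real.rpow_inv_natCast_pow hc hn.ne']
      have h1 := (mul_le_mul_of_nonneg_right (mul_le_mul_of_nonneg_right
        hpow (pow_nonneg hx0.le n))
        (pow_nonneg (by linarith [pow_nonneg hx0.le (4 * T + 6)]) _)).trans (hcore n x hx0 hx1)
      have h2 : ∑ m ∈ Finset.range ((4 * T + 7) * n + 1), (stripCount (T + 1) m : ℝ) * x ^ m ≤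
          (2 * ((T : ℝ) + 2)) * ∑ m ∈ Finset.range ((4 * T + 7) * n + 1), (triSawCount m : ℝ) * x ^ m := by
        rw [Finset.mul_sum]
        refine Finset.sum_le_sum fun m _ => ?_
        have hc : (stripCount (T + 1) m : ℝ) ≤ 2 * ((T : ℝ) + 2) * (triSawCount m : ℝ) := by
          have := stripCount_le (T + 1) m
          have e : ((2 * (T + 1 + 1) * triSawCount m : ℕ) : ℝ) = 2 * ((T : ℝ) + 2) * (triSawCount m : ℝ) := by
            push_cast; ring
          rw [← e]; exact_mod_cast this
        calc (stripCount (T + 1) m : ℝ) * x ^ m ≤ 2 * ((T : ℝ) + 2) * (triSawCount m : ℝ) * x ^ m :=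
            mul_le_mul_of_nonneg_right hc (pow_nonneg hx0.le m)
          _ = 2 * ((T : ℝ) + 2) * ((triSawCount m : ℝ) * x ^ m) := by ring
      calc _ ≤ _ := h1
        _ ≤ 8 * ((2 * ((T : ℝ) + 2)) * ∑ m ∈ Finset.range ((4 * T + 7) * n + 1), (triSawCount m : ℝ) * x ^ m) :=
          mul_le_mul_of_nonneg_left h2 (by norm_num)
        _ = _ := by ring
  have e1 : ((4 * T + 6 : ℕ) : ℝ) = 4 * (T : ℝ) + 6 := by push_cast; ring
  rw [e1, Real.log_exp] at hx
  exact hx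

end Door

end Literature.Probability.RandomPlanarGeometry.SAW.TriStrip
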